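import Literature.Barriers.CriticalPhenomena.PlaquetteWalkHoleRootEastWall
import HarnessLib

/-!
# Barrier catalogue (SAWScalingLimit): THE HOLE ON OR NEXT TO A WALL — four position classes in which the vertex
functional at the far cell VANISHES identically, whatever else is removed

Assembly leaf (no new mechanism, no new definition) of `PlaquetteWalkHoleRootFarCellLaw` (the door-closed zero
`vertexFunctional_printed_farCellW_eq_zero_of_door_closed`: a missing western neighbour `farNW`, `farSW` or `farWW` of
the far cell unwinds every class-`B2a` walk) and `PlaquetteWalkHoleRootEastWall` (`vertexFunctional_printed_eq_zero_of_eastWallRootE`: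
the root plaquette's eastern neighbour missing and the root row shut further east ⇒ no wound walk). Setting: the
`m × n` box of faces minus a list `S` of cells containing the hole `h` but not the far cell `(h.1 − 1, h.2)`; the root
plaquette `w = (h.1 + 1, h.2)` rooted at its `W` side; the Yang–Baxter vertex functional `VF(θ)` with the printed
weights at the far cell, `θ ∈ [π/3, 2π/3]`.

* §1 ★★★★ `westAdjacent_box_vertexFunctional_eq_zero` — `h.1 = 1` (the far cell ON the west wall, its outer neighbour
  `farWW = (−1, h.2)` outside the box): `VF ≡ 0`; ★★★★ `eastAdjacent_box_vertexFunctional_eq_zero` — `h.1 + 2 = m` (the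
  root plaquette ON the east wall, its eastern neighbour outside): `VF ≡ 0`; ★★★★ `bottomRow_box_vertexFunctional_eq_zero`
  / `topRow_box_vertexFunctional_eq_zero` — `h.2 = 0` / `h.2 + 1 = n` (hole and far cell ON the bottom / top row, `farSW` /
  `farNW` outside): `VF ≡ 0`. Each for EVERY list `S ∋ h` avoiding the far cell (any further defects), every `θ` of the range.
* §2 the plain box `boxMinus m n [h]`: the four classes restated (`…_plainBox_…`), and the classification they complete
  (docstring of `plainBox_wallAdjacent_vertexFunctional_eq_zero`): with `PlaquetteWalkHoleRootThinSide` (hole ONE row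
  off the bottom/top wall, `2 ≤ h.1 ≤ m − 3`: `VF ≠ 0` on the whole range, `thinBox_vertexFunctional_ne_zero`; the height-3
  strip: `VF ≡ 0`) and `PlaquetteWalkHoleRootLawLDichotomy` / `…MirrorZeros` (hole `≥ 2` from every wall: nothing killed;
  the mirror zero at `π/2` on a symmetric row) every position of the hole in a plain box now has its typed verdict except
  the sign of `VF` in the free interior off `π/2`.

Not in print; venture lane «pcv-sawmu», seat b-step0 gen 27.

References: A. Glazman, I. Manolescu, arXiv:1708.00395v3, §1, §2.1 and Lemma 2.1 (proof: [Gl]) [GlazmanManolescu2019];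
A. Glazman, Electron. Commun. Probab. 20 (2015) no. 86, Lemma 3.1, proof pp. 6–7 [Glazman2015WeightedSAW].
-/

noncomputable section

open Set Function Complex

namespace Literature.Barriers.CriticalPhenomena.PlaquetteWalk

open Literature.Probability.RandomPlanarGeometry.SAW.YangBaxter
open Real Complex

/-! ## §1 Four vanishing classes, any further defects -/

section AnyDefects

variable {m n : ℕ} {S : List Face} {h : Face}

/-- The far cell of the hole root sits in the box minus `S` when it lies in the box and `S` misses it.
[cite: GlazmanManolescu2019, §2.1 (finite domains of faces)] -/
theorem farW_hroot_mem_boxMinus_of_not_mem (hW : 1 ≤ h.1) (hE : h.1 ≤ m) (hS : 0 ≤ h.2) (hN : h.2 + 1 ≤ n)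
    (hfS : ((h.1 - 1, h.2) : Face) ∉ S) : farW (h.1 + 1, h.2) ∈ boxMinus m n S := by
  rw [mem_boxMinus]; simp only [farW]
  refine ⟨⟨by omega, by omega, by omega, by omega⟩, fun hs => hfS ?_⟩
  have e : ((h.1 + 1 - 2, h.2) : Face) = (h.1 - 1, h.2) := Prod.ext (by simp only; omega) rfl
  rwa [e] at hs

/-- With the hole listed in `S`, the far cell of the box minus `S` is rooted at the hole root as soon as it is present.
[cite: GlazmanManolescu2019, §2.1 (walks start on the boundary of the domain)] -/
theorem rootedFace_hroot_boxMinus_of_mem (hf : farW (h.1 + 1, h.2) ∈ boxMinus m n S) (hh : h ∈ S) :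
    RootedFace (dom (boxMinus m n S)) (Face.side (h.1 + 1, h.2) .W) (farW (h.1 + 1, h.2)) :=
  ⟨hf, fun hb => by
    rw [root_faces_W, holeFaceW_hroot] at hb
    exact not_mem_dom_boxMinus_of_mem hh hb.1⟩

/-- ★★★★ **HOLE NEXT TO THE WEST WALL ⇒ `VF ≡ 0`.** If the hole sits in column `1` (`h.1 = 1`), the far cell `(0, h.2)` lies
ON the west wall and its outer neighbour `farWW = (−1, h.2)` is outside the box: a door of the far cell is closed, no
class-`B2a` walk at the far cell is wound, and the vertex functional with the printed weights vanishes at every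
`θ ∈ [π/3, 2π/3]` — for every list `S` of removed cells containing the hole and missing the far cell.
[cite: GlazmanManolescu2019, Lemma 2.1 (proof: [Gl])] [cite: Glazman2015WeightedSAW, Lemma 3.1 (proof, pp. 6–7)] -/
theorem westAdjacent_box_vertexFunctional_eq_zero (hW : h.1 = 1) (hE : h.1 + 2 ≤ m) (hS : 0 ≤ h.2) (hN : h.2 + 1 ≤ n)
    (hh : h ∈ S) (hfS : ((h.1 - 1, h.2) : Face) ∉ S) {θ : ℝ} (hθ : θ ∈ Set.Icc (π / 3) (2 * π / 3)) :
    vertexFunctional (printedWeights θ) tFiveEighths (ybCoeff θ) (boxMinus m n S) (Face.side (h.1 + 1, h.2) .W)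
      (farW (h.1 + 1, h.2)) = 0 := by
  have hf := farW_hroot_mem_boxMinus_of_not_mem (m := m) (n := n) (by omega) (by omega) hS hN hfS
  have hhD : holeFaceW ((h.1 + 1, h.2) : Face) ∉ dom (boxMinus m n S) := by
    rw [holeFaceW_hroot]; exact not_mem_dom_boxMinus_of_mem hh
  refine vertexFunctional_printed_farCellW_eq_zero_of_door_closed hθ _ _ hf hhD (Or.inr (Or.inr fun hm => ?_))
    (rootedFace_hroot_boxMinus_of_mem hf hh)
  have hb := (mem_dom_boxMinus.1 hm).1
  simp only [farWW] at hb
  omega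

/-- ★★★★ **ROOT PLAQUETTE ON THE EAST WALL ⇒ `VF ≡ 0`.** If the root plaquette `(h.1 + 1, h.2)`
lies in the box's last column (`h.1 + 2 = m`), its eastern neighbour `(h.1 + 2, h.2)` and the whole root row
further east are outside the box: every winding excursion would have to cross the root plaquette's bottom side twice with
two `θ`-corners in `w`, which a wound class-`B2a` walk cannot afford (`PlaquetteWalkHoleRootEastWall`) — NO wound walk,
and the vertex functional vanishes at every `θ ∈ [π/3, 2π/3]`, for every `S ∋ h` missing the far cell.
[cite: GlazmanManolescu2019, Lemma 2.1 (statement, "in the form given in [Gl]"), §2.1] [cite: Glazman2015WeightedSAW, Lemma 3.1 (proof, pp. 6–7)] -/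
theorem eastAdjacent_box_vertexFunctional_eq_zero (hW : 1 ≤ h.1) (hE : h.1 + 2 = m) (hS : 0 ≤ h.2) (hN : h.2 + 1 ≤ n)
    (hh : h ∈ S) (hfS : ((h.1 - 1, h.2) : Face) ∉ S) {θ : ℝ} (hθ : θ ∈ Set.Icc (π / 3) (2 * π / 3)) :
    vertexFunctional (printedWeights θ) tFiveEighths (ybCoeff θ) (boxMinus m n S) (Face.side (h.1 + 1, h.2) .W)
      (farW (h.1 + 1, h.2)) = 0 := by
  have hf := farW_hroot_mem_boxMinus_of_not_mem (m := m) (n := n) hW (by omega) hS hN hfS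
  refine vertexFunctional_printed_eq_zero_of_eastWallRootE hθ hf ?_ (fun hm => ?_) fun x hx => Or.inl fun hm => ?_
  · rw [holeFaceW_hroot]; exact not_mem_dom_boxMinus_of_mem hh
  · have hb := (mem_dom_boxMinus.1 hm).1; simp only at hb; omega
  · have hb := (mem_dom_boxMinus.1 hm).1; simp only at hb hx; omega

/-- ★★★★ **HOLE ON THE BOTTOM ROW ⇒ `VF ≡ 0`.** If `h.2 = 0` the far cell `(h.1 − 1, 0)` lies on the bottom row and its
south-western door `farSW = (h.1 − 1, −1)` is outside the box: door closed, no wound walk, `VF(θ) = 0` on the range, for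
every `S ∋ h` missing the far cell. [cite: GlazmanManolescu2019, Lemma 2.1 (proof: [Gl])] [cite: Glazman2015WeightedSAW, Lemma 3.1 (proof, pp. 6–7)] -/
theorem bottomRow_box_vertexFunctional_eq_zero (hW : 1 ≤ h.1) (hE : h.1 + 2 ≤ m) (hS : h.2 = 0) (hN : 1 ≤ n)
    (hh : h ∈ S) (hfS : ((h.1 - 1, h.2) : Face) ∉ S) {θ : ℝ} (hθ : θ ∈ Set.Icc (π / 3) (2 * π / 3)) :
    vertexFunctional (printedWeights θ) tFiveEighths (ybCoeff θ) (boxMinus m n S) (Face.side (h.1 + 1, h.2) .W)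
      (farW (h.1 + 1, h.2)) = 0 := by
  have hf := farW_hroot_mem_boxMinus_of_not_mem (m := m) (n := n) hW (by omega) (by omega) (by omega) hfS
  have hhD : holeFaceW ((h.1 + 1, h.2) : Face) ∉ dom (boxMinus m n S) := by
    rw [holeFaceW_hroot]; exact not_mem_dom_boxMinus_of_mem hh
  refine vertexFunctional_printed_farCellW_eq_zero_of_door_closed hθ _ _ hf hhD (Or.inr (Or.inl fun hm => ?_))
    (rootedFace_hroot_boxMinus_of_mem hf hh)
  have hb := (mem_dom_boxMinus.1 hm).1
  simp only [farSW] at hb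
  omega

/-- ★★★★ **HOLE ON THE TOP ROW ⇒ `VF ≡ 0`.** If `h.2 + 1 = n` the far cell's north-western door `farNW = (h.1 − 1, n)` is
outside the box: door closed, `VF(θ) = 0` on the range, for every `S ∋ h` missing the far cell.
[cite: GlazmanManolescu2019, Lemma 2.1 (proof: [Gl])] [cite: Glazman2015WeightedSAW, Lemma 3.1 (proof, pp. 6–7)] -/
theorem topRow_box_vertexFunctional_eq_zero (hW : 1 ≤ h.1) (hE : h.1 + 2 ≤ m) (hS : 0 ≤ h.2) (hN : h.2 + 1 = n)
    (hh : h ∈ S) (hfS : ((h.1 - 1, h.2) : Face) ∉ S) {θ : ℝ} (hθ : θ ∈ Set.Icc (π / 3) (2 * π / 3)) :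
    vertexFunctional (printedWeights θ) tFiveEighths (ybCoeff θ) (boxMinus m n S) (Face.side (h.1 + 1, h.2) .W)
      (farW (h.1 + 1, h.2)) = 0 := by
  have hf := farW_hroot_mem_boxMinus_of_not_mem (m := m) (n := n) hW (by omega) hS (by omega) hfS
  have hhD : holeFaceW ((h.1 + 1, h.2) : Face) ∉ dom (boxMinus m n S) := by
    rw [holeFaceW_hroot]; exact not_mem_dom_boxMinus_of_mem hh
  refine vertexFunctional_printed_farCellW_eq_zero_of_door_closed hθ _ _ hf hhD (Or.inl fun hm => ?_)
    (rootedFace_hroot_boxMinus_of_mem hf hh)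
  have hb := (mem_dom_boxMinus.1 hm).1
  simp only [farNW] at hb
  omega

end AnyDefects

/-! ## §2 The plain box: the hole on or next to a wall -/

section PlainBox

variable {m n : ℕ} {h : Face}

/-- ★★★★ **THE PLAIN BOX WITH ITS HOLE ON OR NEXT TO A WALL.** In the `m × n` box minus the single cell `h`, the vertex
functional with the printed weights at the far cell `(h.1 − 1, h.2)` of the hole root `(h.1 + 1, h.2)` vanishes at every
`θ ∈ [π/3, 2π/3]` in each of the four position classes: `h.1 = 1` (far cell on the west wall), `h.1 + 2 = m` (root
plaquette on the east wall), `h.2 = 0` (bottom row), `h.2 + 1 = n` (top row). The remaining classes are typed elsewhere: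
hole ONE row off the bottom/top wall with `2 ≤ h.1 ≤ m − 3` ⇒ `VF ≠ 0` on the whole range (`thinBox_vertexFunctional_ne_zero`,
`n ≥ 4`; the height-3 strip ⇒ `VF ≡ 0`, `stripThreeBox_vertexFunctional_eq_zero`); hole `≥ 2` from every wall ⇒ no route
is killed (`lawL_box_not_killed_of_far` with `S = [h]`) and `VF(π/2) = 0` on a mirror-symmetric row
(`PlaquetteWalkHoleRootMirrorZeros`). [cite: GlazmanManolescu2019, Lemma 2.1 (statement and proof: [Gl]), §2.1]
[cite: Glazman2015WeightedSAW, Lemma 3.1 (proof, pp. 6–7)] -/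
theorem plainBox_wallAdjacent_vertexFunctional_eq_zero (hW : 1 ≤ h.1) (hE : h.1 + 2 ≤ m) (hS : 0 ≤ h.2)
    (hN : h.2 + 1 ≤ n) (hpos : h.1 = 1 ∨ h.1 + 2 = m ∨ h.2 = 0 ∨ h.2 + 1 = n) {θ : ℝ}
    (hθ : θ ∈ Set.Icc (π / 3) (2 * π / 3)) :
    vertexFunctional (printedWeights θ) tFiveEighths (ybCoeff θ) (boxMinus m n [h]) (Face.side (h.1 + 1, h.2) .W)
      (farW (h.1 + 1, h.2)) = 0 := by
  have hh : h ∈ [h] := List.mem_singleton.2 rfl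
  have hfS : ((h.1 - 1, h.2) : Face) ∉ [h] := by
    rw [List.mem_singleton]; intro e; have e' := (Prod.ext_iff.1 e).1; simp only at e'; omega
  rcases hpos with e | e | e | e
  · exact westAdjacent_box_vertexFunctional_eq_zero e hE hS hN hh hfS hθ
  · exact eastAdjacent_box_vertexFunctional_eq_zero hW e hS hN hh hfS hθ
  · exact bottomRow_box_vertexFunctional_eq_zero hW hE e (by omega) hh hfS hθ
  · exact topRow_box_vertexFunctional_eq_zero hW hE hS e hh hfS hθ

end PlainBox

end Literature.Barriers.CriticalPhenomena.PlaquetteWalk
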